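import Summits.ValiantsHypothesis.ValiantsHypothesis.Theses.UlrichPadded
import Literature.Computability.AlgebraicComplexity.StandardFamilies
import Literature.Computability.AlgebraicComplexity.PermanentIrreducible
import Literature.Computability.AlgebraicComplexity.LandsbergRessayreNormalForm
import Literature.Computability.AlgebraicComplexity.VonZurGathenRegularity
import Literature.Computability.AlgebraicComplexity.RankOneDeterminantalExpressionsProofs

/-!
# Crux `RankOneTrivialisation` (stmt-ValiantsHypothesis-5667, route `UlrichPadded`) —
line `corank-one-pencil` (≈ `swan-weight-homotopy`), planner skeleton

Crux (the route's decl, concluded BY NAME below):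
`UlrichPadded.RankOneTrivialisation` — for `n ≥ 3` and every affine determinantal representation
`A` of `per_n` (size `m`) there are polynomial vectors `c, w` and degrees `dc + dw ≤ m - 1` with
`adj A ≡ c·wᵀ (mod per_n)`.

## The line: the weight pencil `A(t·x) = A₀ + t·L(x)` is a corank-one family on `V(per_n) × 𝔸¹`

Write `S = S_n = ℂ[x]/(per_n)` and let `Θ : ℂ[x] → S[t]`, `x_ij ↦ t·x̄_ij`, be the WEIGHT HOMOTOPY
(for an affine `A = A₀ + L(x)`, `Θ(A) = A₀ + t·L(x̄)` is the pencil of the idea card; `Θ` followed by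
`t ↦ 1` is the quotient map, followed by `t ↦ 0` it is "constant term").  Put `B := adj (Θ A)`, a
matrix over `S[t]`.

1. `stub_pencil_adjIdeal_eq_top` — von zur Gathen's corank theorem ALONG THE PENCIL, vertex
   `t = 0` included: `A(t·x)` is `A` evaluated at the point `t·x`, so (vzG, PROVED in tree, every
   point of `ℂ^{n²}`) no point of `ℂ^{n²+1}` kills all submaximal minors of `A(t·x)`; by the
   Nullstellensatz they generate the unit ideal of `ℂ[t, x]`.  ⇒ `B` has unit content.
   (This is where `3 ≤ n` is consumed: Disproof `rankOneTrivialisation_false_without_three_le`.)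
2. `stub_adjugate_minor_mem_of_det_mem` — `2 × 2` minors of an adjugate lie in any PRIME containing
   the determinant (rank argument over the residue field / Jacobi).  With `det A = per_n` and
   `Θ(per_n) = tⁿ·per_n(x̄) = 0`:  ⇒ `B` has rank one.
3. `stub_weightHomotopy_outer` — THE LEVER (𝔸¹-rigidity of `Pic` over `S_n`, matrix form): a
   rank-one unit-content matrix over `S_n[t]` whose `t = 0` value is an outer product is an outer
   product `c(t)·w(t)ᵀ` over `S_n[t]` (Bass–Murthy / Traverso–Swan for the normal ring `S_n`; or —
   now that crux 5666 is PROVED in tree, `Summit.ValiantsHypothesis.Theorems.permQuot_isDomain_and_ufm`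
   — gcd extraction in the UFD `S_n[t]`).  Its `t = 0` input is discharged HERE, sorry-free:
   `B(0) = adj(A₀)` pushed into `S`, and the adjugate of a singular matrix over a field is an outer
   product (`adjugate_eq_vecMulVec_of_det_eq_zero`, from the tree's `exists_vecMulVec_of_rank_le_one`).
4. `stub_outerProduct_budget` — evaluating at `t = 1` gives `adj A mod per_n = c̄·w̄ᵀ` over the graded
   DOMAIN `S_n`; top-degree additivity and homogeneous lifts give polynomial `c, w` with
   `dc + dw ≤ m - 1` (this is where affineness is consumed: Disproof
   `rankOneTrivialisation_false_without_affine`; the bound is `m - 1` exactly, tight at `Bpp`).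

`RankOneTrivialisation_of : UlrichPadded.RankOneTrivialisation` composes 1–4 (A12 shape: the crux by
name, no hypotheses; the sorried `stub_*` are used inside; everything else is proved here).
-/

noncomputable section

set_option linter.dupNamespace false

namespace Summit.ValiantsHypothesis.ValiantsHypothesis.Cruxes.RankOneTrivialisation.CorankOnePencil

open MvPolynomial Matrix Literature.Computability.AlgebraicComplexity

/-! ## The registered stubs -/

/-- **Stub 1 (vzG along the pencil, vertex included; consumes `3 ≤ n`).** For `n ≥ 3` and ANY
polynomial matrix `A` with `det A = per_n`, the submaximal minors of the weight pencil
`A(t·x)` (substitute `x_ij ↦ t·x_ij`; variable `t = X none`) generate the unit ideal of `ℂ[t, x]`: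
at a point `(τ, v)` the pencil is `A` evaluated at `τ·v ∈ ℂ^{n²}`, where `rank ≥ m - 1` by
von zur Gathen 1987 Thm 3.1 (`vonzurGathen1987_perm_detRepr_rank_holds`, or directly
`VonZurGathen.false_of_adjugate_eval_eq_zero`), so no maximal ideal (Nullstellensatz,
`MvPolynomial.isMaximal_iff_eq_vanishingIdeal_singleton`) contains all of them.  False at `n = 2`
(`A₂`: the pencil is `t·A₂`, its adjugate is divisible by `t`). [folklore] -/
theorem stub_pencil_adjIdeal_eq_top :
    ∀ n : ℕ, 3 ≤ n → ∀ (m : ℕ) (A : Matrix (Fin m) (Fin m) (MvPolynomial (Fin n × Fin n) ℂ)),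
      A.det = perPoly (Fin n) ℂ →
        VonZurGathen.adjIdeal
          (A.map (MvPolynomial.aeval fun ij : Fin n × Fin n =>
            (X none * X (some ij) : MvPolynomial (Option (Fin n × Fin n)) ℂ))) = ⊤ := by
  sorry

/-- **Stub 2 (rank one of the adjugate modulo a prime containing the determinant).** Over any
commutative ring, if `det M` lies in a prime `P` then every `2 × 2` minor of `adj M` lies in `P`:
over the residue FIELD of `P`, either `adj M̄ = 0` or `rank M̄ = m - 1` and the columns of `adj M̄`
span the one-dimensional kernel of `M̄` (`M̄ · adj M̄ = det M̄ = 0`); alternatively Jacobi's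
complementary-minor identity gives the minor as `det M` times an `(m-2)`-minor. [folklore] -/
theorem stub_adjugate_minor_mem_of_det_mem :
    ∀ (R : Type) [CommRing R] (P : Ideal R) [P.IsPrime] (m : ℕ) (M : Matrix (Fin m) (Fin m) R),
      M.det ∈ P → ∀ i j k l : Fin m,
        M.adjugate i j * M.adjugate k l - M.adjugate i l * M.adjugate k j ∈ P := by
  sorry

/-- **Stub 3 (THE LEVER: 𝔸¹-rigidity of rank-one unit-content matrices over `S_n[t]`).** For
`n ≥ 3`, a square matrix `B` over `S_n[t]` (`S_n = ℂ[x]/(per_n)`) with all `2 × 2` minors zero,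
entries generating the unit ideal, and `B(0)` an outer product, is an outer product `c(t)·w(t)ᵀ`
over `S_n[t]`.  (Its column module is an invertible `S_n[t]`-module with free `t = 0` fibre; it is
free because `Pic S_n[t] = Pic S_n` for the normal noetherian domain `S_n` — Bass–Murthy 1967 /
Fossum Thm 8.1 + Cor 18.3 / Traverso–Swan — or, cheaper in the present tree, because `S_n` is a UFD
(`Summit.ValiantsHypothesis.Theorems.permQuot_isDomain_and_ufm`, crux 5666 PROVED), hence so is
`S_n[t]`, and a rank-one matrix over a UFD is `c·wᵀ` by gcd extraction of a non-zero column.)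
[folklore] -/
theorem stub_weightHomotopy_outer :
    ∀ n : ℕ, 3 ≤ n → ∀ (m : ℕ)
      (B : Matrix (Fin m) (Fin m)
        (Polynomial (MvPolynomial (Fin n × Fin n) ℂ ⧸ Ideal.span {perPoly (Fin n) ℂ}))),
      (∀ i j k l : Fin m, B i j * B k l = B i l * B k j) →
      Ideal.span (Set.range fun p : Fin m × Fin m => B p.1 p.2) = ⊤ →
      (∃ c₀ w₀ : Fin m → MvPolynomial (Fin n × Fin n) ℂ ⧸ Ideal.span {perPoly (Fin n) ℂ},
          B.map (Polynomial.eval 0) = Matrix.vecMulVec c₀ w₀) →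
        ∃ c w : Fin m → Polynomial (MvPolynomial (Fin n × Fin n) ℂ ⧸ Ideal.span {perPoly (Fin n) ℂ}),
          B = Matrix.vecMulVec c w := by
  sorry

/-- **Stub 4 (outer product modulo `per_n` ⇒ the degree budget; consumes affineness).** For
`n ≥ 3` and a matrix `A` of affine linear forms, if `adj A` reduces modulo `per_n` to an outer
product `c̄·w̄ᵀ` over `S_n`, then `adj A ≡ c·wᵀ (mod per_n)` for POLYNOMIAL vectors with
`deg cᵢ ≤ dc`, `deg wⱼ ≤ dw`, `dc + dw ≤ m - 1`: `S_n` is a graded domain (`per_n` irreducible and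
homogeneous), so at the arg-max pair `deg c̄ᵢ + deg w̄ⱼ = deg (c̄ᵢ w̄ⱼ) ≤ deg (adj A)ᵢⱼ ≤ m - 1`, and
every class has a representative of total degree equal to its degree (drop the homogeneous
components lying in `(per_n)`).  The bound `m - 1` is sharp (Disproof
`rankOneTrivialisation_tight_at_Bpp`). [folklore] -/
theorem stub_outerProduct_budget :
    ∀ n : ℕ, 3 ≤ n → ∀ (m : ℕ) (A : Matrix (Fin m) (Fin m) (MvPolynomial (Fin n × Fin n) ℂ)),
      (∀ i j, (A i j).totalDegree ≤ 1) →
      (∃ c w : Fin m → MvPolynomial (Fin n × Fin n) ℂ ⧸ Ideal.span {perPoly (Fin n) ℂ},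
          A.adjugate.map (Ideal.Quotient.mk (Ideal.span {perPoly (Fin n) ℂ})) =
            Matrix.vecMulVec c w) →
        ∃ (c w : Fin m → MvPolynomial (Fin n × Fin n) ℂ) (dc dw : ℕ), dc + dw ≤ m - 1 ∧
          (∀ i, (c i).totalDegree ≤ dc) ∧ (∀ i, (w i).totalDegree ≤ dw) ∧
          ∀ i j, A.adjugate i j - c i * w j ∈ Ideal.span {perPoly (Fin n) ℂ} := by
  sorry

/-! ## Sorry-free glue: the weight homotopy and its two ends -/

section Glue

/-- Scaling the arguments of a homogeneous polynomial of degree `d` by `c` scales its value by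
`c ^ d` (`eval₂` form of the tree's `IsHomogeneous.aeval_const_mul`, AlderStrassenProofs).
[folklore] -/
theorem eval₂_const_mul_of_isHomogeneous {σ R A : Type*} [CommSemiring R] [CommSemiring A]
    (g : R →+* A) {φ : MvPolynomial σ R} {d : ℕ} (hφ : φ.IsHomogeneous d) (c : A) (y : σ → A) :
    eval₂Hom g (fun i => c * y i) φ = c ^ d * eval₂Hom g y φ := by
  conv_lhs => rw [← φ.support_sum_monomial_coeff]
  conv_rhs => rw [← φ.support_sum_monomial_coeff]
  rw [map_sum, map_sum, Finset.mul_sum]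
  refine Finset.sum_congr rfl fun s hs => ?_
  rw [coe_eval₂Hom, coe_eval₂Hom, eval₂_monomial, eval₂_monomial, hφ.degree_eq_sum_deg_support hs]
  simp only [Finsupp.prod, mul_pow, Finset.prod_mul_distrib, Finset.prod_pow_eq_pow_sum]
  ring

/-- Mapping an outer product entrywise by a ring hom. [folklore] -/
theorem map_vecMulVec {A B : Type*} [CommRing A] [CommRing B] (f : A →+* B) {ι κ : Type*}
    (c : ι → A) (w : κ → A) :
    (Matrix.vecMulVec c w).map f = Matrix.vecMulVec (f ∘ c) (f ∘ w) := by
  ext i j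
  simp [Matrix.vecMulVec_apply]

/-- Adjugate commutes with entrywise ring homs (Mathlib `RingHom.map_adjugate`, `map` form).
[folklore] -/
theorem adjugate_map {A B : Type*} [CommRing A] [CommRing B] (f : A →+* B) {m : ℕ}
    (M : Matrix (Fin m) (Fin m) A) : (M.map f).adjugate = M.adjugate.map f := by
  have h := RingHom.map_adjugate f M
  rw [RingHom.mapMatrix_apply, RingHom.mapMatrix_apply] at h
  exact h.symm

/-- **The `t = 0` end (linear algebra over a field).** The adjugate of a singular square matrix
over a field is an outer product: if `rank N ≤ m - 2` then `adj N = 0`, and if `rank N = m - 1`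
the columns of `adj N` lie in the one-dimensional kernel of `N` (`N · adj N = det N • 1 = 0`).
[folklore] -/
theorem adjugate_eq_vecMulVec_of_det_eq_zero {K : Type*} [Field K] {m : ℕ}
    (N : Matrix (Fin m) (Fin m) K) (hN : N.det = 0) :
    ∃ c w : Fin m → K, N.adjugate = Matrix.vecMulVec c w := by
  apply exists_vecMulVec_of_rank_le_one
  by_cases hlt : N.rank + 1 < m
  · rw [VonZurGathen.adjugate_eq_zero_of_rank_lt hlt, Matrix.rank_zero]
    exact zero_le_one
  · -- `rank N = m - 1`: the range of `adj N` sits inside `ker N`, which is a line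
    have hrk : N.rank < m := by
      have := Matrix.rank_lt_card_of_det_eq_zero hN
      rwa [Fintype.card_fin] at this
    have hle : LinearMap.range N.adjugate.mulVecLin ≤ LinearMap.ker N.mulVecLin := by
      rintro _ ⟨v, rfl⟩
      rw [LinearMap.mem_ker, Matrix.mulVecLin_apply, Matrix.mulVecLin_apply, Matrix.mulVec_mulVec,
        Matrix.mul_adjugate, hN, zero_smul, Matrix.zero_mulVec]
    have hker : Module.finrank K (LinearMap.ker N.mulVecLin) + N.rank = m := by
      rw [Matrix.rank, add_comm]
      have := LinearMap.finrank_range_add_finrank_ker N.mulVecLin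
      rwa [Module.finrank_fintype_fun_eq_card, Fintype.card_fin] at this
    calc N.adjugate.rank = Module.finrank K (LinearMap.range N.adjugate.mulVecLin) := rfl
      _ ≤ Module.finrank K (LinearMap.ker N.mulVecLin) := Submodule.finrank_mono hle
      _ ≤ 1 := by omega

/-- **The pencil argument, abstractly** (all bookkeeping of the line, sorry-free).  Let `K` be a
field, `mk : K[σ] → S` a ring hom killing a homogeneous `f`, and `A` a square matrix over `K[σ]`
with `det A(0) = 0`.  Let `Θ : K[σ] → S[t]`, `x_i ↦ t · mk(x_i)`, be the weight homotopy and
`B := adj (Θ A)`.  IF (rank) the `2 × 2` minors of `adj A` lie in `(f)`, (unit) the submaximal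
minors of the pencil `A(t·x)` generate the unit ideal of `K[t, x]`, and (rigid) every rank-one
unit-content matrix over `S[t]` whose value at `t = 0` is an outer product is an outer product —
THEN `adj A`, pushed to `S`, is an outer product: `B` is rank one (`Θ f = t^d · mk f = 0`), has
unit content (push (unit) along `t ↦ t, x_i ↦ mk x_i`), `B(0) = adj (A(0))` pushed to `S` is an
outer product over `K` (`adjugate_eq_vecMulVec_of_det_eq_zero`), so (rigid) gives
`B = c(t)·w(t)ᵀ`; evaluate at `t = 1`. [folklore] -/
theorem pencil_outerProduct {K : Type*} [Field K] {σ : Type*} {S : Type*} [CommRing S]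
    (mk : MvPolynomial σ K →+* S) {f : MvPolynomial σ K} {d : ℕ} (hf : f.IsHomogeneous d)
    (hmkf : mk f = 0) {m : ℕ} (A : Matrix (Fin m) (Fin m) (MvPolynomial σ K))
    (hdet0 : constantCoeff A.det = 0)
    (hrank : ∀ i j k l : Fin m,
      A.adjugate i j * A.adjugate k l - A.adjugate i l * A.adjugate k j ∈ Ideal.span {f})
    (hunit : VonZurGathen.adjIdeal
      (A.map (MvPolynomial.aeval fun i : σ => (X none * X (some i) : MvPolynomial (Option σ) K)))
        = ⊤)
    (hrigid : ∀ B : Matrix (Fin m) (Fin m) (Polynomial S),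
      (∀ i j k l : Fin m, B i j * B k l = B i l * B k j) →
      Ideal.span (Set.range fun p : Fin m × Fin m => B p.1 p.2) = ⊤ →
      (∃ c₀ w₀ : Fin m → S, B.map (Polynomial.eval 0) = Matrix.vecMulVec c₀ w₀) →
        ∃ c w : Fin m → Polynomial S, B = Matrix.vecMulVec c w) :
    ∃ c w : Fin m → S, A.adjugate.map mk = Matrix.vecMulVec c w := by
  -- the weight homotopy `Θ : x_i ↦ t · mk(x_i)`, constants `r ↦ mk r`
  set Θ : MvPolynomial σ K →+* Polynomial S :=
    eval₂Hom (Polynomial.C.comp (mk.comp C)) fun i => Polynomial.X * Polynomial.C (mk (X i))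
    with hΘ
  have hΘX : ∀ i, Θ (X i) = Polynomial.X * Polynomial.C (mk (X i)) := fun i => eval₂Hom_X' _ _ i
  have hΘC : ∀ r : K, Θ (C r) = Polynomial.C (mk (C r)) := fun r => eval₂Hom_C _ _ r
  -- `Θ f = t^d · mk f = 0`, hence `Θ` kills `(f)`
  have hΘf : Θ f = 0 := by
    have h1 := eval₂_const_mul_of_isHomogeneous (Polynomial.C.comp (mk.comp C)) hf
      (Polynomial.X : Polynomial S) (fun i => Polynomial.C (mk (X i)))
    have h2 : (eval₂Hom (Polynomial.C.comp (mk.comp C)) fun i : σ => Polynomial.C (mk (X i))) =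
        Polynomial.C.comp mk := by
      refine MvPolynomial.ringHom_ext (fun r => ?_) (fun i => ?_)
      · rw [eval₂Hom_C]; rfl
      · rw [eval₂Hom_X']; rfl
    rw [h2, RingHom.comp_apply, hmkf, map_zero, mul_zero] at h1
    rw [hΘ]
    exact h1
  have hΘI : ∀ x ∈ Ideal.span {f}, Θ x = 0 := fun x hx => by
    obtain ⟨q, rfl⟩ := Ideal.mem_span_singleton'.mp hx
    rw [map_mul, hΘf, mul_zero]
  -- `B := adj (Θ A) = Θ (adj A)`
  set B : Matrix (Fin m) (Fin m) (Polynomial S) := (A.map Θ).adjugate with hB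
  have hBentry : B = A.adjugate.map Θ := by rw [hB, adjugate_map]
  -- (1) rank one
  have h1 : ∀ i j k l : Fin m, B i j * B k l = B i l * B k j := by
    intro i j k l
    have h0 := hΘI _ (hrank i j k l)
    rw [map_sub, map_mul, map_mul] at h0
    rw [hBentry]
    simp only [Matrix.map_apply]
    exact sub_eq_zero.mp h0
  -- (2) unit content: push (unit) along `Θ' : K[t, x] → S[t]`, `t ↦ t`, `x_i ↦ mk x_i`
  have h2 : Ideal.span (Set.range fun p : Fin m × Fin m => B p.1 p.2) = ⊤ := by
    set θ₀ : MvPolynomial σ K →ₐ[K] MvPolynomial (Option σ) K :=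
      MvPolynomial.aeval fun i : σ => (X none * X (some i) : MvPolynomial (Option σ) K) with hθ₀
    set Θ' : MvPolynomial (Option σ) K →+* Polynomial S :=
      eval₂Hom (Polynomial.C.comp (mk.comp C)) fun o : Option σ =>
        Option.elim o Polynomial.X fun i => Polynomial.C (mk (X i)) with hΘ'
    have hcomp : Θ = Θ'.comp (θ₀ : MvPolynomial σ K →+* MvPolynomial (Option σ) K) := by
      refine MvPolynomial.ringHom_ext (fun r => ?_) (fun i => ?_)
      · rw [hΘC, RingHom.comp_apply, RingHom.coe_coe, hθ₀, MvPolynomial.aeval_C,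
          MvPolynomial.algebraMap_eq, hΘ', eval₂Hom_C]
        rfl
      · rw [hΘX, RingHom.comp_apply, RingHom.coe_coe, hθ₀, MvPolynomial.aeval_X, map_mul, hΘ',
          eval₂Hom_X', eval₂Hom_X']
        rfl
    have hfun : (Θ : MvPolynomial σ K → Polynomial S) = Θ' ∘ θ₀ := by
      rw [hcomp]
      rfl
    have hB' : B = ((A.map θ₀).adjugate).map Θ' := by
      rw [hB, hfun, ← Matrix.map_map, adjugate_map]
    have hrange : (Set.range fun p : Fin m × Fin m => B p.1 p.2) =
        Θ' '' Set.range (fun p : Fin m × Fin m => (A.map θ₀).adjugate p.1 p.2) := by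
      rw [← Set.range_comp, hB']
      rfl
    rw [hrange, ← Ideal.map_span]
    change Ideal.map Θ' (VonZurGathen.adjIdeal (A.map θ₀)) = ⊤
    rw [hθ₀, hunit, Ideal.map_top]
  -- (3) the `t = 0` end: `B(0)` is `adj (A(0))` pushed to `S`, an outer product over `K`
  have h3 : ∃ c₀ w₀ : Fin m → S, B.map (Polynomial.eval 0) = Matrix.vecMulVec c₀ w₀ := by
    have hev0 : (Polynomial.evalRingHom 0).comp Θ = (mk.comp C).comp constantCoeff := by
      refine MvPolynomial.ringHom_ext (fun r => ?_) (fun i => ?_)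
      · rw [RingHom.comp_apply, hΘC, RingHom.comp_apply, constantCoeff_C, Polynomial.coe_evalRingHom,
          Polynomial.eval_C]
        rfl
      · rw [RingHom.comp_apply, hΘX, RingHom.comp_apply, constantCoeff_X, map_zero,
          Polynomial.coe_evalRingHom, Polynomial.eval_mul, Polynomial.eval_X, zero_mul]
    have hNdet : (A.map constantCoeff).det = 0 := by
      rw [← RingHom.mapMatrix_apply, ← RingHom.map_det]
      exact hdet0
    obtain ⟨c, w, hcw⟩ := adjugate_eq_vecMulVec_of_det_eq_zero _ hNdet
    refine ⟨(mk.comp C) ∘ c, (mk.comp C) ∘ w, ?_⟩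
    have hB0 : B.map (Polynomial.eval 0) = ((A.map constantCoeff).adjugate).map (mk.comp C) := by
      rw [hB, ← Polynomial.coe_evalRingHom, ← adjugate_map, Matrix.map_map, ← RingHom.coe_comp,
        hev0, RingHom.coe_comp, ← Matrix.map_map, adjugate_map]
    rw [hB0, hcw, map_vecMulVec]
  -- (4) rigidity: `B = c(t) · w(t)ᵀ` over `S[t]`; evaluate at `t = 1` (`ev₁ ∘ Θ = mk`)
  obtain ⟨c, w, hcw⟩ := hrigid B h1 h2 h3
  have hev1 : (Polynomial.evalRingHom 1).comp Θ = mk := by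
    refine MvPolynomial.ringHom_ext (fun r => ?_) (fun i => ?_)
    · rw [RingHom.comp_apply, hΘC, Polynomial.coe_evalRingHom, Polynomial.eval_C]
    · rw [RingHom.comp_apply, hΘX, Polynomial.coe_evalRingHom, Polynomial.eval_mul,
        Polynomial.eval_X, Polynomial.eval_C, one_mul]
  refine ⟨fun i => (c i).eval 1, fun j => (w j).eval 1, ?_⟩
  have e1 : A.adjugate.map mk = B.map (Polynomial.evalRingHom 1) := by
    rw [← hev1, RingHom.coe_comp, ← Matrix.map_map, hBentry]
  rw [e1, hcw, map_vecMulVec]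
  rfl

end Glue

/-! ## The kernel-checked composition -/

/-- **The line closes the crux.**  Instantiate `pencil_outerProduct` at `K = ℂ`,
`S = S_n = ℂ[x]/(per_n)`, `mk` the quotient map, `f = per_n` (homogeneous of degree `n`, killed by
`mk`, zero constant term): (rank) is stub 2 at the prime `(per_n)`, (unit) is stub 1, (rigid) is
stub 3; the resulting outer product `adj A mod per_n = c̄·w̄ᵀ` is lifted within the budget `m - 1`
by stub 4. [folklore] -/
theorem RankOneTrivialisation_of :
    Summit.ValiantsHypothesis.ValiantsHypothesis.Theses.UlrichPadded.RankOneTrivialisation := by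
  intro n hn m A hA
  -- `(per_n)` is prime: `per_n` is irreducible in the UFD `ℂ[x]`
  haveI : Nonempty (Fin n) := ⟨⟨0, by omega⟩⟩
  have hp : Prime (perPoly (Fin n) ℂ) :=
    UniqueFactorizationMonoid.irreducible_iff_prime.mp perPoly_irreducible
  haveI hIprime : (Ideal.span {perPoly (Fin n) ℂ}).IsPrime :=
    (Ideal.span_singleton_prime hp.ne_zero).mpr hp
  have hmem : A.det ∈ Ideal.span {perPoly (Fin n) ℂ} := by
    rw [hA.2]
    exact Ideal.subset_span rfl
  refine stub_outerProduct_budget n hn m A hA.1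
    (pencil_outerProduct (Ideal.Quotient.mk (Ideal.span {perPoly (Fin n) ℂ}))
      (perPoly_isHomogeneous (n := Fin n) (k := ℂ))
      (Ideal.Quotient.eq_zero_iff_mem.mpr (Ideal.subset_span rfl)) A ?_
      (stub_adjugate_minor_mem_of_det_mem _ (Ideal.span {perPoly (Fin n) ℂ}) m A hmem)
      (stub_pencil_adjIdeal_eq_top n hn m A hA.2) (stub_weightHomotopy_outer n hn m))
  -- `det A(0) = per_n(0) = 0`
  rw [hA.2]
  exact constantCoeff_perPoly ℂ (by omega)

end Summit.ValiantsHypothesis.ValiantsHypothesis.Cruxes.RankOneTrivialisation.CorankOnePencil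

end
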